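import Summits.QuantumFields.GaugeBoot.StaggeredParityTwist
import Summits.QuantumFields.GaugeBoot.ZdPlaquetteInsertion
import Summits.QuantumFields.GaugeBoot.ClassBHaarShift
import Literature.MathematicalPhysics.QuantumLattice.LatticeGaugeDLRProofs
import HarnessLib

/-!
# The staggered central twist `β ↦ -β` on the INFINITE lattice `ℤ^d`: one-link Gibbs states,
# translations and gauge transformations (gauge-boot, L3 structural supplement; `ℤ^d` twist 1/7)

HONEST FRAMING (cell `pub-gaugeboot`, page 1 of every file): the venture produces certified bounds
on lattice expectations at stated coupling, gauge group, dimension and torus size; NOT a mass gap,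
NOT a continuum limit, NOT a string tension; NOT Yang–Mills-summit-bearing (barriers
`FixedCouplingUltralocality`, `PerturbativeInvisibility`). This module bounds no expectation; no
certificate of the cell sits at `β < 0`. Structural bookkeeping for the Class-B / Class-T
interfaces (`ClassB.lean`, `TiltedBoxLimitClass.lean`) at negative coupling.

`StaggeredCentralTwist.lean` / `StaggeredParityTwist.lean` twist the Wilson measure of a FINITE
periodic lattice at `β` onto the one at `-β` (Kogut–Susskind phases `s(x, m) = z^{∑_{m' ≺ m} x_{m'}}`,
`z` central, `z² = 1`, `ρ z = -1`: `SU(2)`, `SU(2n)`, `U(N)`; Li–Meurice 2005). On the infinite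
lattice there is no Wilson measure to twist; the objects are STATES — probability measures on
`LGConfig d G = ZdEdge d → G` — and their axioms (`IsHaarShiftState`, `IsZdTranslationInvariant`,
reflection positivities). The tree's `ℤ^d` configurations ARE the periodic-lattice configurations
`TiltedRP.Config (Site d) d G` of `(A, e) = (ℤ^d, zdUnit)` (`ZdPlaquetteInsertion.lean`), so the twist
`centralTwist s` and the staggering `stagTwist π r z` (parities `π_m(x) = x_m mod 2`, any axis `r`
last) apply verbatim. This file (1/7) proves, for any staggering `s` of `(ℤ^d, zdUnit)` with value `z`,
`ρ z = -1`:

* `plaquetteHolonomyZd_centralTwist`, `plaquetteObs_centralTwist` (`u_p ↦ -u_p`),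
  `wilsonBoundaryAction_centralTwist` (`S_Λ(TU) = 2N·#{p : p ∩ Λ ≠ ∅} - S_Λ(U)`),
  `centralTwist_update_mul` (the twist commutes with the one-link left shifts);
* ★★ `IsHaarShiftState.map_centralTwist` — **the twist carries one-link Gibbs (Haar-shift) states at
  `β` to one-link Gibbs states at `-β`**: `IsHaarShiftState ρ β μ → IsHaarShiftState ρ (-β) (μ ∘ T⁻¹)`
  (any `d`, any compact metrisable `G`, continuous `ρ` with `ρ z = -1`, every real `β`);
* `gaugeTransformZd_centralTwist` (the twist commutes with every gauge transformation),
  `centralTwist_const_eq_gaugeTransformZd` (a twist by weights depending only on the DIRECTION of the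
  link is the gauge transformation `x ↦ z^{∑_m c_m x_m}`), ★ `configShift_centralTwist_stagTwist`
  (**translations commute with the parity twist up to such a gauge transformation**:
  `τ_v ∘ T = g_v ∘ T ∘ τ_v`), and hence ★★ `isZdTranslationInvariant_map_centralTwist`: the twist of a
  translation-invariant GAUGE-INVARIANT state is translation invariant (and gauge invariant,
  `map_gaugeTransformZd_map_centralTwist`).

Sequels: `ZdCentralTwistSymmetries.lean` (the twist versus the three reflection families and axis
permutations: commutation up to explicit `ℤ/2` gauge transformations), `ZdCentralTwistStates.lean`
and `ZdCentralTwistClasses.lean` (invariances and reflection positivity of twisted states — site and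
link mirrors: ALL half observables; diagonal mirrors: gauge-invariant half observables; the twist
of a Class-B / Class-T state), `ZdCentralTwistLimitPoints.lean` (even-side torus limit points at `β`
and `-β` correspond), `ZdCentralTwistDLR.lean` (the DLR specification: `𝒢(-β) = T 𝒢(β)`),
`ZdCentralTwistWilsonLoops.lean` (rectangular Wilson loops: `W_{R×T} ↦ (-1)^{RT} W_{R×T}`).

What is NOT claimed: nothing for `SU(3)` / `SU(2n+1)` (no central involution with `ρ z = -1`); no
statement about FULL (gauge-variant) link/diagonal reflection positivity of twisted states — by
`ClassBNegativeCouplingEmpty.lean` a twisted Class-B state at `-β < 0` is NOT a Class-B state;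
nothing at `β ≥ 0` changes. Structural; NOT a bound on any expectation. [folklore] bookkeeping.

References: L. Li, Y. Meurice, Phys. Rev. D 71 (2005) 016008 §II (the `β ↦ -β` twist for `SU(2N)`
on even lattices); J. Kogut, L. Susskind, Phys. Rev. D 11 (1975) 395 (staggered phases);
H.-O. Georgii, Gibbs Measures and Phase Transitions (2011), Def. 2.9, (5.3)–(5.4) (one-site kernels,
translations); E. Seiler, LNP 159 (1982) Ch. 2 (the one-link DLR kernel of lattice gauge theory).
-/

noncomputable section

open MeasureTheory
open Literature.Probability.LatticeModels (Site)
open Literature.MathematicalPhysics.QuantumLattice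

namespace Summit.QuantumFields.GaugeBoot

namespace TiltedRP

variable {d N : ℕ} {G : Type*} [Group G]

/-! ## The twist on `ℤ^d` configurations: plaquettes, boundary action, one-link shifts -/

section Algebra

variable {z : G} {s : ZdEdge d → G}

/-- **Every `ℤ^d` plaquette holonomy is multiplied by `z`** under a staggering of `(ℤ^d, zdUnit)`:
`(T_s U)_p = z · U_p` (`i ≠ j`). -/
theorem IsStaggering.plaquetteHolonomyZd_centralTwist (hs : IsStaggering (zdUnit d) z s)
    (U : LGConfig d G) (x : Site d) {i j : Fin d} (hij : i ≠ j) :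
    plaquetteHolonomyZd (centralTwist s U) x i j = z * plaquetteHolonomyZd U x i j :=
  hs.holonomy_centralTwist U x hij

variable (ρ : G →* Matrix (Fin N) (Fin N) ℂ)

/-- **The twist reverses every plaquette observable**: `Re tr ρ((T_s U)_p) = -Re tr ρ(U_p)` when
`ρ z = -1` (`i ≠ j`). -/
theorem IsStaggering.plaquetteObs_centralTwist (hs : IsStaggering (zdUnit d) z s) (hρz : ρ z = -1)
    (x : Site d) {i j : Fin d} (hij : i ≠ j) (U : LGConfig d G) :
    plaquetteObs ρ x i j (centralTwist s U) = -plaquetteObs ρ x i j U := by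
  unfold plaquetteObs
  rw [hs.plaquetteHolonomyZd_centralTwist U x hij, map_mul, hρz, neg_mul, one_mul, Matrix.trace_neg,
    Complex.neg_re]

/-- **The boundary Wilson action under the twist**: `S_Λ(T_s U) = 2N·#(plaquettes touching Λ) - S_Λ(U)`
(each plaquette term `N - Re tr ρ(U_p)` becomes `N + Re tr ρ(U_p)`). -/
theorem IsStaggering.wilsonBoundaryAction_centralTwist (hs : IsStaggering (zdUnit d) z s)
    (hρz : ρ z = -1) (Λ : Finset (ZdEdge d)) (U : LGConfig d G) :
    wilsonBoundaryAction ρ Λ (centralTwist s U) =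
      2 * N * (plaquettesTouching Λ).card - wilsonBoundaryAction ρ Λ U := by
  unfold wilsonBoundaryAction
  have h : ∀ p ∈ plaquettesTouching Λ,
      ((N : ℝ) - plaquetteObs ρ p.1 p.2.1.1 p.2.1.2 (centralTwist s U)) =
        2 * N - ((N : ℝ) - plaquetteObs ρ p.1 p.2.1.1 p.2.1.2 U) := by
    intro p _
    rw [hs.plaquetteObs_centralTwist ρ hρz p.1 (ne_of_lt p.2.2) U]
    ring
  rw [Finset.sum_congr rfl h, Finset.sum_sub_distrib, Finset.sum_const, nsmul_eq_mul]
  ring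

/-- **The difference of boundary actions is reversed by the twist**:
`S_Λ(T V) - S_Λ(T U) = -(S_Λ(V) - S_Λ(U))`. -/
theorem IsStaggering.wilsonBoundaryAction_centralTwist_sub (hs : IsStaggering (zdUnit d) z s)
    (hρz : ρ z = -1) (Λ : Finset (ZdEdge d)) (U V : LGConfig d G) :
    wilsonBoundaryAction ρ Λ (centralTwist s V) - wilsonBoundaryAction ρ Λ (centralTwist s U) =
      -(wilsonBoundaryAction ρ Λ V - wilsonBoundaryAction ρ Λ U) := by
  rw [hs.wilsonBoundaryAction_centralTwist ρ hρz, hs.wilsonBoundaryAction_centralTwist ρ hρz]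
  ring

omit ρ

/-- **The twist commutes with the one-link left shifts** `U ↦ U[e ↦ g U_e]` (the weights are
central): `T_s (U[e ↦ g U_e]) = (T_s U)[e ↦ g (T_s U)_e]`. -/
theorem centralTwist_update_mul (hcomm : ∀ l g, s l * g = g * s l) (U : LGConfig d G)
    (e : ZdEdge d) (g : G) :
    centralTwist s (Function.update U e (g * U e)) =
      Function.update (centralTwist s U) e (g * centralTwist s U e) := by
  funext l
  by_cases hl : l = e
  · subst hl
    simp only [centralTwist_apply, Function.update_self, ← mul_assoc, hcomm]
  · simp only [centralTwist_apply, Function.update_of_ne hl]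

/-- **The twist commutes with every gauge transformation** (central weights):
`(T_s U)^g = T_s (U^g)`. -/
theorem gaugeTransformZd_centralTwist (hcomm : ∀ l g, s l * g = g * s l) (k : Site d → G)
    (U : LGConfig d G) :
    gaugeTransformZd k (centralTwist s U) = centralTwist s (gaugeTransformZd k U) := by
  funext l
  simp only [gaugeTransformZd, centralTwist_apply]
  rw [← mul_assoc (k l.1) (s l) (U l), ← hcomm l (k l.1)]
  simp only [mul_assoc]

/-- The twist preserves cylinder observables: `F` depends on the links of `S` iff `F ∘ T_s` does
(one direction). -/
theorem dependsOn_comp_centralTwist (s : ZdEdge d → G) {α : Type*} {F : LGConfig d G → α}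
    {S : Set (ZdEdge d)} (hF : DependsOn F S) : DependsOn (F ∘ centralTwist s) S :=
  fun _ _ hUV => hF fun l hl => by simp only [centralTwist_apply, hUV l hl]

/-- The twist preserves cylinder observables (`IsCylinder` form). -/
theorem isCylinder_comp_centralTwist (s : ZdEdge d → G) {α : Type*} {F : LGConfig d G → α}
    {S : Finset (ZdEdge d)} (hF : IsCylinder F S) : IsCylinder (F ∘ centralTwist s) S :=
  dependsOn_comp_centralTwist s hF

/-- The twist is continuous (product topology). -/
theorem continuous_centralTwist [TopologicalSpace G] [ContinuousMul G] (s : ZdEdge d → G) :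
    Continuous (centralTwist (d := d) s : LGConfig d G → LGConfig d G) :=
  continuous_pi fun l => continuous_const.mul (continuous_apply l)

end Algebra

/-! ## One-link Gibbs (Haar-shift) states: `β ↦ -β` -/

section HaarShift

variable [TopologicalSpace G] [IsTopologicalGroup G] [MeasurableSpace G] [BorelSpace G]
  [SecondCountableTopology G]
variable (ρ : G →* Matrix (Fin N) (Fin N) ℂ) {z : G} {s : ZdEdge d → G}

omit [SecondCountableTopology G] in
/-- The twisted state `μ ∘ T_s⁻¹` is a probability measure. -/
theorem isProbabilityMeasure_map_centralTwist (s : ZdEdge d → G) (μ : Measure (LGConfig d G))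
    [IsProbabilityMeasure μ] : IsProbabilityMeasure (μ.map (centralTwist s)) :=
  Measure.isProbabilityMeasure_map (measurable_centralTwist s).aemeasurable

/-- Change of variables: `∫ F d(μ ∘ T_s⁻¹) = ∫ F ∘ T_s dμ` for continuous `F`. -/
theorem integral_map_centralTwist (s : ZdEdge d → G) (μ : Measure (LGConfig d G))
    {F : LGConfig d G → ℝ} (hF : Continuous F) :
    ∫ U, F U ∂(μ.map (centralTwist s)) = ∫ U, F (centralTwist s U) ∂μ :=
  integral_map (measurable_centralTwist s).aemeasurable hF.aestronglyMeasurable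

omit [SecondCountableTopology G] in
/-- Change of variables, complex-valued measurable integrand. -/
theorem integral_map_centralTwist_of_measurable (s : ZdEdge d → G) (μ : Measure (LGConfig d G))
    {F : LGConfig d G → ℂ} (hF : Measurable F) :
    ∫ U, F U ∂(μ.map (centralTwist s)) = ∫ U, F (centralTwist s U) ∂μ :=
  integral_map (measurable_centralTwist s).aemeasurable hF.aestronglyMeasurable

/-- ★★ **The twist carries one-link Gibbs states at `β` to one-link Gibbs states at `-β`.** For a
staggering `s` of `(ℤ^d, zdUnit)` with value `z`, a continuous `ρ` with `ρ z = -1`, and a measure `μ`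
obeying the one-link Haar-shift (DLR) identity of the Wilson action at coupling `β`
(`IsHaarShiftState ρ β μ`), the image measure `μ ∘ T_s⁻¹` obeys it at coupling `-β`. Proof: `T_s`
commutes with the one-link shifts and reverses the difference of boundary actions; the identity for
`μ` is applied to the continuous cylinder observable `f ∘ T_s`. -/
theorem _root_.Summit.QuantumFields.GaugeBoot.IsHaarShiftState.map_centralTwist (hs : IsStaggering (zdUnit d) z s) (hρ : Continuous ρ)
    (hρz : ρ z = -1) {β : ℝ} {μ : Measure (LGConfig d G)} (hμ : IsHaarShiftState ρ β μ) :
    IsHaarShiftState ρ (-β) (μ.map (centralTwist s)) := by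
  intro e g f S hfS hfc
  have hS : Continuous (wilsonBoundaryAction (G := G) ρ {e}) := continuous_wilsonBoundaryAction ρ hρ _
  have hT : Continuous (centralTwist (d := d) s : LGConfig d G → LGConfig d G) :=
    continuous_centralTwist s
  have hwc : Continuous fun U : LGConfig d G => Real.exp (-(-β *
      (wilsonBoundaryAction ρ {e} (Function.update U e (g⁻¹ * U e)) -
        wilsonBoundaryAction ρ {e} U))) :=
    Real.continuous_exp.comp ((((hS.comp (continuous_update_mul e g⁻¹)).sub hS).const_smul (-β)).neg)
  rw [integral_map_centralTwist s μ (F := fun U => f (Function.update U e (g * U e)))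
      (hfc.comp (continuous_update_mul e g)),
    integral_map_centralTwist s μ (F := fun U => f U * Real.exp (-(-β *
      (wilsonBoundaryAction ρ {e} (Function.update U e (g⁻¹ * U e)) - wilsonBoundaryAction ρ {e} U))))
      (hfc.mul hwc)]
  have h1 : ∀ U : LGConfig d G, f (Function.update (centralTwist s U) e (g * centralTwist s U e)) =
      (f ∘ centralTwist s) (Function.update U e (g * U e)) := fun U => by
    rw [Function.comp_apply, centralTwist_update_mul hs.comm]
  have h2 : ∀ U : LGConfig d G, f (centralTwist s U) * Real.exp (-(-β *
      (wilsonBoundaryAction ρ {e} (Function.update (centralTwist s U) e (g⁻¹ * centralTwist s U e)) -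
        wilsonBoundaryAction ρ {e} (centralTwist s U)))) =
      (f ∘ centralTwist s) U * Real.exp (-(β *
        (wilsonBoundaryAction ρ {e} (Function.update U e (g⁻¹ * U e)) -
          wilsonBoundaryAction ρ {e} U))) := fun U => by
    rw [Function.comp_apply, ← centralTwist_update_mul hs.comm,
      hs.wilsonBoundaryAction_centralTwist_sub ρ hρz]
    ring_nf
  simp_rw [h1, h2]
  exact hμ e g (f ∘ centralTwist s) S (isCylinder_comp_centralTwist s hfS) (hfc.comp hT)

omit [SecondCountableTopology G] in
/-- The twist is an involution on measures: `μ = (μ ∘ T_s⁻¹) ∘ T_s⁻¹`. -/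
theorem eq_map_centralTwist_map_centralTwist (hs : IsStaggering (zdUnit d) z s)
    (μ : Measure (LGConfig d G)) : μ = (μ.map (centralTwist s)).map (centralTwist s) := by
  rw [Measure.map_map (measurable_centralTwist s) (measurable_centralTwist s),
    hs.centralTwist_involutive.comp_self, Measure.map_id]

/-- ★★ **`β ↦ -β` is a bijection of one-link Gibbs states**: `μ` is a Haar-shift state at `-β` iff
its twist is one at `β`. -/
theorem isHaarShiftState_map_centralTwist_iff (hs : IsStaggering (zdUnit d) z s) (hρ : Continuous ρ)
    (hρz : ρ z = -1) (β : ℝ) (μ : Measure (LGConfig d G)) :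
    IsHaarShiftState ρ β (μ.map (centralTwist s)) ↔ IsHaarShiftState ρ (-β) μ := by
  refine ⟨fun h => ?_, fun h => by simpa using h.map_centralTwist ρ hs hρ hρz⟩
  have h' := h.map_centralTwist ρ hs hρ hρz
  rwa [← eq_map_centralTwist_map_centralTwist hs μ] at h'

end HaarShift

/-! ## Gauge transformations and translations -/

section Gauge

variable [TopologicalSpace G] [IsTopologicalGroup G] [MeasurableSpace G] [BorelSpace G]
  {s : ZdEdge d → G}

/-- **The twist of a gauge-invariant measure is gauge invariant.** -/
theorem map_gaugeTransformZd_map_centralTwist (hcomm : ∀ l g, s l * g = g * s l)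
    {μ : Measure (LGConfig d G)} (hμ : ∀ k : Site d → G, μ.map (gaugeTransformZd k) = μ)
    (k : Site d → G) :
    (μ.map (centralTwist s)).map (gaugeTransformZd k) = μ.map (centralTwist s) := by
  rw [Measure.map_map (measurable_gaugeTransformZd k) (measurable_centralTwist s),
    show gaugeTransformZd k ∘ centralTwist s = centralTwist s ∘ gaugeTransformZd k from
      funext fun U => gaugeTransformZd_centralTwist hcomm k U,
    ← Measure.map_map (measurable_centralTwist s) (measurable_gaugeTransformZd k), hμ k]

end Gauge

section Parity

variable {z : G}

/-- **A twist by weights depending only on the direction of the link is a gauge transformation**: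
for `c : Fin d → ℤ/2`, `(x, m) ↦ z^{c_m} U(x, m)` is `U ↦ U^g` with `g(x) = z^{∑_m c_m x_m}`
(`z` central, `z² = 1`). -/
theorem centralTwist_const_eq_gaugeTransformZd (hzc : ∀ g : G, z * g = g * z) (hz2 : z * z = 1)
    (c : Fin d → ZMod 2) {t : ZdEdge d → G} (ht : ∀ l, t l = zpow₂ z (c l.2)) (U : LGConfig d G) :
    centralTwist t U =
      gaugeTransformZd (fun x : Site d => zpow₂ z (∑ m, c m * (x m : ZMod 2))) U := by
  have hzc' : ∀ (a : ZMod 2) (g : G), zpow₂ z a * g = g * zpow₂ z a := fun a g => by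
    unfold zpow₂; split_ifs <;> simp [hzc]
  have hinv : ∀ a : ZMod 2, (zpow₂ z a)⁻¹ = zpow₂ z a := fun a => by
    unfold zpow₂; split_ifs
    · exact inv_eq_of_mul_eq_one_right hz2
    · exact inv_one
  funext l
  rw [centralTwist_apply, ht l]
  obtain ⟨x, m⟩ := l
  simp only [gaugeTransformZd]
  rw [hinv, mul_assoc, ← hzc', ← mul_assoc, ← zpow₂_add hz2]
  congr 2
  have hsum : ∑ k, c k * (((x + Pi.single m (1 : ℤ) : Site d) k : ℤ) : ZMod 2) =
      ∑ k, c k * (x k : ZMod 2) + c m := by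
    simp only [Pi.add_apply, Int.cast_add, mul_add, Finset.sum_add_distrib]
    congr 1
    rw [Finset.sum_eq_single m (fun k _ hk => by rw [Pi.single_eq_of_ne hk, Int.cast_zero, mul_zero])
      (fun h => absurd (Finset.mem_univ m) h), Pi.single_eq_same, Int.cast_one, mul_one]
  rw [hsum]
  have h2 : ∀ a b : ZMod 2, a + (a + b) = b := by decide
  exact (h2 _ _).symm

variable {π : Fin d → Site d →+ ZMod 2}

/-- **On `ℤ^d` the dual parities are the coordinate parities**: `π_m(x) = x_m mod 2`. -/
theorem IsDualParity.apply_zd (hπ : IsDualParity (zdUnit d) π) (m : Fin d) (x : Site d) :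
    π m x = (x m : ZMod 2) := by
  have hx : x = ∑ k, Pi.single k (x k) := (Finset.univ_sum_single x).symm
  conv_lhs => rw [hx]
  rw [map_sum]
  have hk : ∀ k, π m (Pi.single k (x k)) = if m = k then (x k : ZMod 2) else 0 := fun k => by
    have h1 : (Pi.single k (x k) : Site d) = x k • zdUnit d k := by
      rw [zdUnit_apply, ← Pi.single_smul', smul_eq_mul, mul_one]
    rw [h1, map_zsmul, hπ m k]
    split_ifs <;> simp
  simp_rw [hk]
  rw [Finset.sum_ite_eq Finset.univ m, if_pos (Finset.mem_univ m)]

/-- The staggered parity is additive in the base point: `c(x + y, m) = c(x, m) + c(y, m)`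
(any periodic lattice). -/
theorem stagParity_add {A : Type*} [AddCommGroup A] (π : Fin d → A →+ ZMod 2) (r : Fin d)
    (x y : A) (m : Fin d) :
    stagParity π r (x + y, m) = stagParity π r (x, m) + stagParity π r (y, m) := by
  simp only [stagParity, map_add, Finset.sum_add_distrib]

/-- The staggered parity of a negated base point: `c(-x, m) = c(x, m)` (values in `ℤ/2`). -/
theorem stagParity_neg {A : Type*} [AddCommGroup A] (π : Fin d → A →+ ZMod 2) (r : Fin d)
    (x : A) (m : Fin d) : stagParity π r (-x, m) = stagParity π r (x, m) := by
  simp only [stagParity, map_neg, Finset.sum_neg_distrib]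
  exact ZMod.neg_eq_self_mod_two _

/-- ★ **Translations commute with the parity twist up to a gauge transformation**: for the
Kogut–Susskind staggering `s = stagTwist π r z` of `ℤ^d` and every `v ∈ ℤ^d`,
`τ_v (T_s U) = (T_s (τ_v U))^{g_v}` with the `ℤ/2`-gauge function
`g_v(x) = z^{∑_m c(v, m) x_m}` (`c` the staggered parity). -/
theorem configShift_centralTwist_stagTwist (hzc : ∀ g : G, z * g = g * z) (hz2 : z * z = 1)
    (r : Fin d) [MeasurableSpace G] (v : Site d) (U : LGConfig d G) :
    configShift v (centralTwist (stagTwist π r z) U) =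
      gaugeTransformZd (fun x : Site d => zpow₂ z (∑ m, stagParity π r (v, m) * (x m : ZMod 2)))
        (centralTwist (stagTwist π r z) (configShift v U)) := by
  rw [← centralTwist_const_eq_gaugeTransformZd hzc hz2 (fun m => stagParity π r (v, m))
    (t := fun l => zpow₂ z (stagParity π r (v, l.2))) (fun _ => rfl)]
  funext l
  obtain ⟨x, m⟩ := l
  simp only [configShift_apply, centralTwist_apply, stagTwist]
  rw [← mul_assoc, ← zpow₂_add hz2, sub_eq_add_neg x v, stagParity_add, stagParity_neg, add_comm]

variable [TopologicalSpace G] [IsTopologicalGroup G] [MeasurableSpace G] [BorelSpace G]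

/-- ★★ **The twist of a translation-invariant, gauge-invariant state is translation invariant.** -/
theorem isZdTranslationInvariant_map_centralTwist (hzc : ∀ g : G, z * g = g * z) (hz2 : z * z = 1)
    (r : Fin d) {μ : Measure (LGConfig d G)} (hμT : IsZdTranslationInvariant μ)
    (hμG : ∀ k : Site d → G, μ.map (gaugeTransformZd k) = μ) :
    IsZdTranslationInvariant (μ.map (centralTwist (stagTwist π r z))) := by
  intro v
  have hcomm : ∀ (l : ZdEdge d) (g : G), stagTwist π r z l * g = g * stagTwist π r z l :=
    fun l g => by unfold stagTwist zpow₂; split_ifs <;> simp [hzc]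
  set k : Site d → G := fun x => zpow₂ z (∑ m, stagParity π r (v, m) * (x m : ZMod 2)) with hk
  have hT := measurable_centralTwist (d := d) (A := Site d) (G := G) (stagTwist π r z)
  calc (μ.map (centralTwist (stagTwist π r z))).map (configShift v)
      = μ.map (configShift v ∘ centralTwist (stagTwist π r z)) :=
        Measure.map_map (configShift v).measurable hT
    _ = μ.map ((gaugeTransformZd k ∘ centralTwist (stagTwist π r z)) ∘ configShift v) := by
        congr 1
        funext U
        exact configShift_centralTwist_stagTwist hzc hz2 r v U
    _ = (μ.map (configShift v)).map (gaugeTransformZd k ∘ centralTwist (stagTwist π r z)) :=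
        (Measure.map_map ((measurable_gaugeTransformZd k).comp hT) (configShift v).measurable).symm
    _ = μ.map (gaugeTransformZd k ∘ centralTwist (stagTwist π r z)) := by rw [hμT v]
    _ = (μ.map (centralTwist (stagTwist π r z))).map (gaugeTransformZd k) :=
        (Measure.map_map (measurable_gaugeTransformZd k) hT).symm
    _ = μ.map (centralTwist (stagTwist π r z)) := map_gaugeTransformZd_map_centralTwist hcomm hμG k

end Parity

end TiltedRP

end Summit.QuantumFields.GaugeBoot
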